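import Mathlib
import HarnessLib.Audit
import Summits.PneNP.PneNP.Theorems.PstarPDTUpper
import Summits.PneNP.PneNP.Theorems.PstarGapLemma

/-!
# Free closings: the cycle identity of a pure `P⋆` family (ROUND-24, basic tool for `|W| ≥ 2`)

FRONTIER range-avoidance ladder, rung F-N3, ROUND 24 (cell `pnp-ideate`; restricted-model proof complexity — nothing here bears
on `P` versus `NP`).

The planner memo (ROUND-24-PRESEED §13 R8, R10) reasons throughout with FREE CLOSINGS: if a family `F` of outputs
`x_t + x_{t'} + a_p a_q = y` is XOR-EVEN — every variable occurs an even number of times among the XOR slots of `F` (an even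
subgraph / cycle of the XOR graph `H[F]`) — then summing the equations cancels the XOR layer and leaves the cost-free quadratic relation
`Σ_{g ∈ F} a_{p_g} a_{q_g} = Σ_{g ∈ F} y_g` on every solution of `F`.  This file makes that formal, for use in the `|W| ≥ 2` analysis
(T24.18 / T24.21: pinned products vanish or linearise inside a closing; when all but one product of a closing with odd target is
killed, the last one is forced to `1` — ACTIVATION):

* `xorMult I F v` — the multiplicity of `v` among the XOR slots of `F`; `bit_sum_eval` — the sum of the output bits of ANY family;
* `sum_xor_eq_zero` — for an XOR-even family the XOR layer sums to `0`; `closing` — the identity on solutions;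
* `forced_product` / `forced_true` — all but one product killed (an AND slot `false`) forces the last product to the closing's target.
-/

set_option linter.dupNamespace false

open Finset Literature.Computability.Complexity
open Summit.PneNP.PneNP.Theorems.PstarFibrePolys (bit bit_xor bit_and bit_injective)
open Summit.PneNP.PneNP.Theorems.PstarPDT (bit_eval)

namespace Summit.PneNP.PneNP.Theorems.PstarClosing

variable {n m : ℕ}

/-- Multiplicity of the variable `v` among the XOR slots (slots `0, 1`) of the outputs of `F`. -/
def xorMult (I : LocalMap 4 n m) (F : Finset (Fin m)) (v : Fin n) : ℕ :=
  (F.filter fun g => I.vars g 0 = v).card + (F.filter fun g => I.vars g 1 = v).card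

/-- **Sum of output bits** of a pure family: XOR layer plus products. -/
theorem bit_sum_eval (I : LocalMap 4 n m) (hI : I.IsPure xorAndPred) (F : Finset (Fin m)) (z : Fin n → Bool) :
    ∑ g ∈ F, bit (I.eval z g) =
      ∑ g ∈ F, (bit (z (I.vars g 0)) + bit (z (I.vars g 1))) + ∑ g ∈ F, bit (z (I.vars g 2)) * bit (z (I.vars g 3)) := by
  rw [← sum_add_distrib]
  exact sum_congr rfl fun g _ => bit_eval hI z g

/-- The XOR layer, counted by variables: `Σ_{g ∈ F} (z_{t_g} + z_{t'_g}) = Σ_v xorMult(v) · z_v`. -/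
theorem sum_xor_eq_sum_mult (I : LocalMap 4 n m) (F : Finset (Fin m)) (z : Fin n → Bool) :
    ∑ g ∈ F, (bit (z (I.vars g 0)) + bit (z (I.vars g 1))) = ∑ v : Fin n, (xorMult I F v : ZMod 2) * bit (z v) := by
  classical
  rw [sum_add_distrib]
  have h0 : ∑ g ∈ F, bit (z (I.vars g 0)) = ∑ v : Fin n, ((F.filter fun g => I.vars g 0 = v).card : ZMod 2) * bit (z v) := by
    rw [← sum_fiberwise_of_maps_to' (t := (univ : Finset (Fin n))) (g := fun g => I.vars g 0) (fun g _ => mem_univ _)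
      (fun v => bit (z v))]
    exact sum_congr rfl fun v _ => by rw [sum_const, nsmul_eq_mul]
  have h1 : ∑ g ∈ F, bit (z (I.vars g 1)) = ∑ v : Fin n, ((F.filter fun g => I.vars g 1 = v).card : ZMod 2) * bit (z v) := by
    rw [← sum_fiberwise_of_maps_to' (t := (univ : Finset (Fin n))) (g := fun g => I.vars g 1) (fun g _ => mem_univ _)
      (fun v => bit (z v))]
    exact sum_congr rfl fun v _ => by rw [sum_const, nsmul_eq_mul]
  rw [h0, h1, ← sum_add_distrib]
  refine sum_congr rfl fun v _ => ?_
  unfold xorMult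
  push_cast
  ring

/-- **XOR-even families cancel the XOR layer.** -/
theorem sum_xor_eq_zero (I : LocalMap 4 n m) {F : Finset (Fin m)} (hF : ∀ v : Fin n, Even (xorMult I F v)) (z : Fin n → Bool) :
    ∑ g ∈ F, (bit (z (I.vars g 0)) + bit (z (I.vars g 1))) = 0 := by
  rw [sum_xor_eq_sum_mult]
  refine sum_eq_zero fun v _ => ?_
  rw [(ZMod.natCast_eq_zero_iff_even).2 (hF v), zero_mul]

/-- **The free closing.**  On a solution of an XOR-even family `F`: `Σ_{g ∈ F} a_{p_g} a_{q_g} = Σ_{g ∈ F} y_g` (in `𝔽₂`). -/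
theorem closing (I : LocalMap 4 n m) (hI : I.IsPure xorAndPred) {F : Finset (Fin m)} (hF : ∀ v : Fin n, Even (xorMult I F v))
    {y : Fin m → Bool} {z : Fin n → Bool} (hz : ∀ g ∈ F, I.eval z g = y g) :
    ∑ g ∈ F, bit (z (I.vars g 2)) * bit (z (I.vars g 3)) = ∑ g ∈ F, bit (y g) := by
  have h := bit_sum_eval I hI F z
  rw [sum_xor_eq_zero I hF z, zero_add] at h
  rw [← h]
  exact sum_congr rfl fun g hg => by rw [hz g hg]

/-- A killed product: an output with a `false` AND slot contributes `0`. -/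
theorem bit_mul_eq_zero_of_false {z : Fin n → Bool} {p q : Fin n} (h : z p = false ∨ z q = false) : bit (z p) * bit (z q) = 0 := by
  rcases h with h | h <;> simp [h, bit]

/-- **Forced product.**  If every output of an XOR-even family `F` except `g₀` has a `false` AND slot at the solution `z`, then the
product of `g₀` equals the closing's target `Σ_{g ∈ F} y_g`. -/
theorem forced_product (I : LocalMap 4 n m) (hI : I.IsPure xorAndPred) {F : Finset (Fin m)}
    (hF : ∀ v : Fin n, Even (xorMult I F v)) {y : Fin m → Bool} {z : Fin n → Bool} (hz : ∀ g ∈ F, I.eval z g = y g)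
    {g₀ : Fin m} (hg₀ : g₀ ∈ F) (hkill : ∀ g ∈ F, g ≠ g₀ → z (I.vars g 2) = false ∨ z (I.vars g 3) = false) :
    bit (z (I.vars g₀ 2)) * bit (z (I.vars g₀ 3)) = ∑ g ∈ F, bit (y g) := by
  classical
  rw [← closing I hI hF hz, ← add_sum_erase _ _ hg₀, sum_eq_zero fun g hg =>
    bit_mul_eq_zero_of_false (hkill g (mem_of_mem_erase hg) (ne_of_mem_erase hg)), add_zero]

/-- **Activation by a closing.**  Under the hypotheses of `forced_product`, if the target `Σ_{g ∈ F} y_g` is odd then both AND slots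
of `g₀` are `true`. -/
theorem forced_true (I : LocalMap 4 n m) (hI : I.IsPure xorAndPred) {F : Finset (Fin m)}
    (hF : ∀ v : Fin n, Even (xorMult I F v)) {y : Fin m → Bool} {z : Fin n → Bool} (hz : ∀ g ∈ F, I.eval z g = y g)
    {g₀ : Fin m} (hg₀ : g₀ ∈ F) (hkill : ∀ g ∈ F, g ≠ g₀ → z (I.vars g 2) = false ∨ z (I.vars g 3) = false)
    (hodd : Odd (F.filter fun g => y g = true).card) :
    z (I.vars g₀ 2) = true ∧ z (I.vars g₀ 3) = true := by
  classical
  have h := forced_product I hI hF hz hg₀ hkill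
  have htarget : ∑ g ∈ F, bit (y g) = 1 := by
    have : ∑ g ∈ F, bit (y g) = ((F.filter fun g => y g = true).card : ZMod 2) := by
      rw [Finset.natCast_card_filter]
      exact sum_congr rfl fun g _ => by cases y g <;> simp [bit]
    rw [this, (ZMod.natCast_eq_one_iff_odd).2 hodd]
  rw [htarget] at h
  revert h
  cases z (I.vars g₀ 2) <;> cases z (I.vars g₀ 3) <;> simp [bit]

/-- **Killing by a closing.**  Under the hypotheses of `forced_product`, if the target is even then the product of `g₀` vanishes:
one of its AND slots is `false`. -/
theorem forced_false (I : LocalMap 4 n m) (hI : I.IsPure xorAndPred) {F : Finset (Fin m)}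
    (hF : ∀ v : Fin n, Even (xorMult I F v)) {y : Fin m → Bool} {z : Fin n → Bool} (hz : ∀ g ∈ F, I.eval z g = y g)
    {g₀ : Fin m} (hg₀ : g₀ ∈ F) (hkill : ∀ g ∈ F, g ≠ g₀ → z (I.vars g 2) = false ∨ z (I.vars g 3) = false)
    (heven : Even (F.filter fun g => y g = true).card) :
    z (I.vars g₀ 2) = false ∨ z (I.vars g₀ 3) = false := by
  classical
  have h := forced_product I hI hF hz hg₀ hkill
  have htarget : ∑ g ∈ F, bit (y g) = 0 := by
    have : ∑ g ∈ F, bit (y g) = ((F.filter fun g => y g = true).card : ZMod 2) := by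
      rw [Finset.natCast_card_filter]
      exact sum_congr rfl fun g _ => by cases y g <;> simp [bit]
    rw [this, (ZMod.natCast_eq_zero_iff_even).2 heven]
  rw [htarget] at h
  revert h
  cases z (I.vars g₀ 2) <;> cases z (I.vars g₀ 3) <;> simp [bit]

/-- XOR-evenness is preserved by symmetric difference (the cycle space). -/
theorem xorMult_symmDiff_even (I : LocalMap 4 n m) {F F' : Finset (Fin m)} (hF : ∀ v : Fin n, Even (xorMult I F v))
    (hF' : ∀ v : Fin n, Even (xorMult I F' v)) (v : Fin n) : Even (xorMult I (symmDiff F F') v) := by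
  classical
  have key : ∀ (p : Fin m → Prop) [DecidablePred p],
      ((symmDiff F F').filter p).card + 2 * ((F ∩ F').filter p).card = (F.filter p).card + (F'.filter p).card := by
    intro p _
    have h1 : (symmDiff F F').filter p = (F.filter p) \ (F'.filter p) ∪ ((F'.filter p) \ (F.filter p)) := by
      ext g; simp only [mem_filter, mem_symmDiff, mem_union, mem_sdiff]; tauto
    have h2 : (F ∩ F').filter p = (F.filter p) ∩ (F'.filter p) := by
      ext g; simp only [mem_filter, mem_inter]; tauto
    rw [h1, h2, card_union_of_disjoint (disjoint_sdiff_sdiff)]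
    have h3 := card_sdiff_add_card_inter (F.filter p) (F'.filter p)
    have h4 := card_sdiff_add_card_inter (F'.filter p) (F.filter p)
    rw [inter_comm (F'.filter p)] at h4
    omega
  have e0 := key (fun g => I.vars g 0 = v)
  have e1 := key (fun g => I.vars g 1 = v)
  have hsum : xorMult I (symmDiff F F') v + 2 * (((F ∩ F').filter fun g => I.vars g 0 = v).card +
      ((F ∩ F').filter fun g => I.vars g 1 = v).card) = xorMult I F v + xorMult I F' v := by
    unfold xorMult; omega
  obtain ⟨a, ha⟩ := hF v
  obtain ⟨b, hb⟩ := hF' v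
  refine ⟨a + b - (((F ∩ F').filter fun g => I.vars g 0 = v).card + ((F ∩ F').filter fun g => I.vars g 1 = v).card), ?_⟩
  omega

end Summit.PneNP.PneNP.Theorems.PstarClosing
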